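import Summits.BirchSwinnertonDyer.BirchSwinnertonDyer.Theses.CountingDoorF2AtThree
import Summits.BirchSwinnertonDyer.Rank2.F2DensityAlgebra
import Literature.NumberTheory.EllipticCurves.PAdicRegulatorFiniteIndexProofs
import Literature.NumberTheory.EllipticCurves.FormalGroupMultiplication
import Literature.NumberTheory.EllipticCurves.BinaryQuarticMinimisationPrimeProofs
import Summits.BirchSwinnertonDyer.BirchSwinnertonDyer.Theorems.CountingDoorF2AtThreeSchneiderOnDoorSubfamilyStubHasDensityOnOneOfForall
import HarnessLib

/-!
# BirchSwinnertonDyer / CountingDoorF2AtThree — support lemmas for crux I4loc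
# `SchneiderOnDoorSubfamily` (stmt-BirchSwinnertonDyer-19682): the FIRST-DIGIT CERTIFICATE KERNEL
# for Schneider's conjecture at `p = 3` in rank two

Route `route-BirchSwinnertonDyer-CountingDoorF2AtThree` (cell bsd-rank2; TWIN leaf
`PAdicBSDRankTwoPositiveProportion`), line «valuation class at 3» for I4loc (planner p2 GEN 11,
`HOME/p2/PADIC-R2-G11.md` §2; numerical shape from the seat's kit jobs j254980 / j255085 / j255100,
`HOME/bsd-rank2-eng-2/data/t12/T12.md`). For a `3`-adic height datum `D` on `E(ℚ)`, two points
`P, Q` and multipliers `N₁, N₂` put `A = ⟨N₁P, N₁P⟩`, `B = ⟨N₂Q, N₂Q⟩`, `C = ⟨N₁P + N₂Q, N₁P + N₂Q⟩`.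
Then (bilinearity and symmetry only)

  `4·A·B − (C − A − B)² = 4·N₁²·N₂² · det Gram_D(P, Q)`        (`four_mul_sq_mul_padicRegulatorOf_pair`)

and the **digit lemma** (`four_mul_mul_sub_sq_ne_zero_of_digits`): if `A/3`, `B/3`, `C/3` are
`3`-adic integers with residues `d_A, d_B, d_C (mod 3)` and `3 ∤ d_A d_B − (d_C − d_A − d_B)²`, then
`4AB − (C−A−B)² ≠ 0` (its `9⁻¹`-multiple is a `3`-adic unit). Hence `det Gram_D(P,Q) ≠ 0`
(`padicRegulatorOf_pair_ne_zero_of_digits`) and, when `rank E(ℚ) = 2`, Schneider's conjecture for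
`D` (`schneiderConjecture_of_digits`, via the tree's `schneiderConjecture_of_padicRegulatorOf_pair_ne_zero`).
The variant `…_of_nonresidue_digits` needs only `A` and `B`: residues with `d_A d_B ≡ 2 (mod 3)` (a
non-square) and `‖C‖ ≤ 3⁻¹` — the third height's digit is then irrelevant. On the family `F₂` at the
door prime `3` this is used with `N₁ = 2`, `N₂ = 3` (the reductions of the marked points have orders
`2` and `3`), `A = ĥ₃(2P₁)`, `B = ĥ₃(3P₂)`; the kit census finds 24 classes of `(a₁,a₂,a₂′,a₃) mod 9`
where the digit hypothesis holds for every sampled member (T12.md). Nothing here is specific to `F₂`: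
pure `3`-adic bookkeeping, no named fact. PARTITION: none — r_an ≥ 2, summit axis S0; TWIN (D-0056):
n/a. B1 honesty: no analytic rank, no `L`-function; no S0 motion.

References: B. Mazur, J. Tate, J. Teitelbaum, Invent. Math. 84 (1986) §II.4 (p-adic regulator)
[MazurTateTeitelbaum1986Invent]; P. Schneider, Invent. Math. 69 (1982) §1 [Schneider1982PadicHeightI];
B. Mazur, W. Stein, J. Tate, *Computation of p-adic heights and log convergence*, Doc. Math. 2006, §1–2
[MazurSteinTate2006].
-/

set_option linter.dupNamespace false

noncomputable section

open scoped Classical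
open Filter Topology
open WeierstrassCurve Literature.NumberTheory.EllipticCurves
  Literature.NumberTheory.EllipticCurves.BhargavaHo2022
  Summit.BirchSwinnertonDyer.Rank2
  Summit.BirchSwinnertonDyer.BirchSwinnertonDyer.Theses.CountingDoorF2AtThree

namespace Summit.BirchSwinnertonDyer.BirchSwinnertonDyer.Theorems

/-! ### §1 `p`-adic digit arithmetic -/

section Digits

variable {p : ℕ} [Fact p.Prime]

/-- An element within distance `< 1` of an integer is a `p`-adic integer. [folklore] -/
theorem norm_le_one_of_norm_sub_intCast_lt_one {x : ℚ_[p]} {d : ℤ} (h : ‖x - d‖ < 1) :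
    ‖x‖ ≤ 1 := by
  have hx : x = (x - d) + d := by ring
  rw [hx]
  exact (Padic.nonarchimedean _ _).trans (max_le h.le (Padic.norm_int_le_one d))

/-- Products respect first digits: `‖x − d‖ < 1`, `‖y − e‖ < 1` ⇒ `‖xy − de‖ < 1`. [folklore] -/
theorem norm_mul_sub_intCast_mul_lt_one {x y : ℚ_[p]} {d e : ℤ} (hx : ‖x - d‖ < 1)
    (hy : ‖y - e‖ < 1) : ‖x * y - d * e‖ < 1 := by
  have hxle := norm_le_one_of_norm_sub_intCast_lt_one hx
  have hsplit : x * y - d * e = x * (y - e) + (x - d) * e := by ring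
  rw [hsplit]
  refine (Padic.nonarchimedean _ _).trans_lt (max_lt ?_ ?_)
  · rw [norm_mul]
    exact mul_lt_one_of_nonneg_of_lt_one_right hxle (norm_nonneg _) hy
  · rw [norm_mul]
    calc ‖x - d‖ * ‖(e : ℚ_[p])‖ ≤ ‖x - d‖ * 1 := by
          gcongr
          exact Padic.norm_int_le_one e
      _ < 1 := by simpa using hx

/-- Differences respect first digits. [folklore] -/
theorem norm_sub_sub_intCast_sub_lt_one {x y : ℚ_[p]} {d e : ℤ} (hx : ‖x - d‖ < 1)
    (hy : ‖y - e‖ < 1) : ‖(x - y) - ((d - e : ℤ) : ℚ_[p])‖ < 1 := by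
  have hsplit : (x - y) - ((d - e : ℤ) : ℚ_[p]) = (x - d) - (y - e) := by push_cast; ring
  rw [hsplit]
  exact (padic_norm_sub_le_max _ _).trans_lt (max_lt hx hy)

/-- An element within distance `< 1` of a `p`-adic unit integer is nonzero (indeed a unit). [folklore] -/
theorem norm_eq_one_of_norm_sub_intCast_lt_one {x : ℚ_[p]} {m : ℤ} (hm : ¬ (p : ℤ) ∣ m)
    (h : ‖x - m‖ < 1) : ‖x‖ = 1 := by
  have hmn := BinaryQuartic.norm_intCast_eq_one (p := p) hm
  have hne : ‖x - m‖ ≠ ‖(m : ℚ_[p])‖ := by rw [hmn]; exact h.ne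
  have := Padic.add_eq_max_of_ne hne
  rw [sub_add_cancel, hmn, max_eq_right h.le] at this
  exact this

end Digits

/-- **The digit lemma at `p = 3`.** If `A/3`, `B/3`, `C/3` have first `3`-adic digits
`d_A, d_B, d_C` (`‖A/3 − d_A‖ < 1`, …) and `3 ∤ d_A d_B − (d_C − d_A − d_B)²`, then
`4AB − (C − A − B)² ≠ 0`: indeed `(4AB − (C−A−B)²)/9 ≡ 4 d_A d_B − (d_C − d_A − d_B)² ≡
d_A d_B − (d_C − d_A − d_B)² (mod 3)` is a unit. [folklore] -/
theorem four_mul_mul_sub_sq_ne_zero_of_digits {A B C : ℚ_[3]} {dA dB dC : ℤ}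
    (hA : ‖A / 3 - dA‖ < 1) (hB : ‖B / 3 - dB‖ < 1) (hC : ‖C / 3 - dC‖ < 1)
    (hcrit : ¬ (3 : ℤ) ∣ dA * dB - (dC - dA - dB) ^ 2) :
    4 * A * B - (C - A - B) ^ 2 ≠ 0 := by
  set a : ℚ_[3] := A / 3 with ha
  set b : ℚ_[3] := B / 3 with hb
  set c : ℚ_[3] := C / 3 with hc
  have hX : 4 * A * B - (C - A - B) ^ 2 = 9 * (4 * a * b - (c - a - b) ^ 2) := by
    rw [ha, hb, hc]; ring
  set m : ℤ := 4 * dA * dB - (dC - dA - dB) ^ 2 with hmdef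
  have hm : ¬ (3 : ℤ) ∣ m := by
    intro h
    apply hcrit
    have e : dA * dB - (dC - dA - dB) ^ 2 = m - 3 * (dA * dB) := by rw [hmdef]; ring
    rw [e]
    exact dvd_sub h (dvd_mul_right 3 _)
  -- the element is within `< 1` of the unit integer `m`
  have hab : ‖a * b - dA * dB‖ < 1 := norm_mul_sub_intCast_mul_lt_one hA hB
  have hcab : ‖(c - a - b) - ((dC - dA - dB : ℤ) : ℚ_[3])‖ < 1 := by
    have h1 := norm_sub_sub_intCast_sub_lt_one hC hA
    have h2 := norm_sub_sub_intCast_sub_lt_one h1 hB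
    simpa [sub_sub] using h2
  have hsq : ‖(c - a - b) * (c - a - b) -
      ((dC - dA - dB : ℤ) : ℚ_[3]) * ((dC - dA - dB : ℤ) : ℚ_[3])‖ < 1 := by
    have := norm_mul_sub_intCast_mul_lt_one hcab hcab
    simpa using this
  have hz : ‖(4 * a * b - (c - a - b) ^ 2) - (m : ℚ_[3])‖ < 1 := by
    have e : (4 * a * b - (c - a - b) ^ 2) - (m : ℚ_[3]) =
        4 * (a * b - dA * dB) - ((c - a - b) * (c - a - b) -
          ((dC - dA - dB : ℤ) : ℚ_[3]) * ((dC - dA - dB : ℤ) : ℚ_[3])) := by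
      rw [hmdef]; push_cast; ring
    rw [e]
    refine (padic_norm_sub_le_max _ _).trans_lt (max_lt ?_ hsq)
    rw [norm_mul]
    calc ‖(4 : ℚ_[3])‖ * ‖a * b - dA * dB‖ ≤ 1 * ‖a * b - dA * dB‖ := by
          gcongr
          exact_mod_cast Padic.norm_int_le_one (p := 3) 4
      _ < 1 := by simpa using hab
  have hunit : ‖4 * a * b - (c - a - b) ^ 2‖ = 1 :=
    norm_eq_one_of_norm_sub_intCast_lt_one (p := 3) (by exact_mod_cast hm) hz
  intro h0
  rw [hX] at h0
  have h9 : (9 : ℚ_[3]) ≠ 0 := by norm_num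
  have hzero : 4 * a * b - (c - a - b) ^ 2 = 0 := (mul_eq_zero.1 h0).resolve_left h9
  rw [hzero, norm_zero] at hunit
  exact zero_ne_one hunit

/-- In `𝔽₃` a non-square minus a square is nonzero: if `d_A d_B ≡ 2 (mod 3)` then
`3 ∤ d_A d_B − s²` for every integer `s`. [folklore] -/
theorem not_three_dvd_sub_sq_of_mul_emod_eq_two {dA dB : ℤ} (h : dA * dB % 3 = 2) (s : ℤ) :
    ¬ (3 : ℤ) ∣ dA * dB - s ^ 2 := by
  intro hd
  have key : ∀ x y : ZMod 3, x - y ^ 2 = 0 → x ≠ 2 := by decide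
  have h1 : ((dA * dB - s ^ 2 : ℤ) : ZMod 3) = 0 := (ZMod.intCast_zmod_eq_zero_iff_dvd _ 3).2 hd
  push_cast at h1
  have h2 := key _ _ h1
  apply h2
  have h3 : ((dA * dB : ℤ) : ZMod 3) = ((2 : ℤ) : ZMod 3) := by
    rw [ZMod.intCast_eq_intCast_iff_dvd_sub]
    have := Int.emod_emod_of_dvd (dA * dB) (dvd_refl (3 : ℤ))
    omega
  push_cast at h3
  exact h3

/-- Every `3`-adic number of norm `≤ 3⁻¹` is `3·(integer digit + smaller)`: there is `d ∈ ℤ` with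
`‖C/3 − d‖ < 1`. [folklore] -/
theorem exists_digit_of_norm_le {C : ℚ_[3]} (hC : ‖C‖ ≤ (3 : ℝ)⁻¹) : ∃ d : ℤ, ‖C / 3 - d‖ < 1 := by
  have h3 : ‖C / 3‖ ≤ 1 := by
    rw [norm_div]
    have : ‖(3 : ℚ_[3])‖ = (3 : ℝ)⁻¹ := by exact_mod_cast Padic.norm_p (p := 3)
    rw [this, div_le_iff₀ (by norm_num)]
    simpa using hC
  set x : ℤ_[3] := ⟨C / 3, h3⟩ with hx
  obtain ⟨n, -, hn⟩ := PadicInt.exists_mem_range x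
  refine ⟨n, ?_⟩
  rw [IsLocalRing.mem_maximalIdeal, mem_nonunits_iff, PadicInt.isUnit_iff] at hn
  have hlt : ‖x - (n : ℤ_[3])‖ < 1 := lt_of_le_of_ne (PadicInt.norm_le_one _) hn
  rw [PadicInt.norm_def, PadicInt.coe_sub, PadicInt.coe_natCast] at hlt
  have hcoe : ((x : ℤ_[3]) : ℚ_[3]) = C / 3 := rfl
  rw [hcoe] at hlt
  exact_mod_cast hlt

/-! ### §2 The Gram determinant of a pair through multiples -/

section Gram

variable {W : WeierstrassCurve ℚ} {p : ℕ} [Fact p.Prime] (D : PAdicHeightData W p)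

/-- The `2 × 2` regulator is `⟨P,P⟩⟨Q,Q⟩ − ⟨P,Q⟩²`. [cite: MazurTateTeitelbaum1986Invent, §II.4 (p-adic regulator)] -/
theorem padicRegulatorOf_pair_eq (P Q : W.toAffine.Point) :
    padicRegulatorOf D ![P, Q] = D.pairing P P * D.pairing Q Q - D.pairing P Q * D.pairing P Q := by
  unfold padicRegulatorOf PAdicHeightData.pairingMatrix
  have e := Matrix.det_fin_two (Matrix.of fun i j => D.pairing (![P, Q] i) (![P, Q] j))
  simp only [Matrix.of_apply, Matrix.cons_val_zero, Matrix.cons_val_one, D.symm Q P] at e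
  convert e using 3

/-- **Gram through multiples.** With `A = ⟨N₁P, N₁P⟩`, `B = ⟨N₂Q, N₂Q⟩`, `C = ⟨N₁P + N₂Q, N₁P + N₂Q⟩`:
`4AB − (C − A − B)² = 4 N₁² N₂² · det Gram(P, Q)` (bilinearity and symmetry of the pairing; this is
how heights of ADMISSIBLE multiples control the regulator of the points themselves).
[cite: MazurSteinTate2006, §1 (the height is quadratic, extended from the good subgroup)] -/
theorem four_mul_sq_mul_padicRegulatorOf_pair (P Q : W.toAffine.Point) (N₁ N₂ : ℕ) :
    4 * D.pairing (N₁ • P) (N₁ • P) * D.pairing (N₂ • Q) (N₂ • Q) -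
        (D.pairing (N₁ • P + N₂ • Q) (N₁ • P + N₂ • Q) - D.pairing (N₁ • P) (N₁ • P) -
          D.pairing (N₂ • Q) (N₂ • Q)) ^ 2 =
      4 * (N₁ : ℚ_[p]) ^ 2 * (N₂ : ℚ_[p]) ^ 2 * padicRegulatorOf D ![P, Q] := by
  rw [padicRegulatorOf_pair_eq]
  simp only [map_add, map_nsmul, AddMonoidHom.add_apply, AddMonoidHom.nsmul_apply, nsmul_eq_mul,
    D.symm Q P]
  ring

end Gram

/-! ### §3 The certificate -/

section Certificate

variable {W : WeierstrassCurve ℚ} (D : PAdicHeightData W 3)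

/-- **First-digit certificate for the pair regulator at `3`.** If the heights
`A = ⟨N₁P,N₁P⟩`, `B = ⟨N₂Q,N₂Q⟩`, `C = ⟨N₁P+N₂Q, N₁P+N₂Q⟩` of a `3`-adic height datum have
`‖A/3 − d_A‖ < 1`, `‖B/3 − d_B‖ < 1`, `‖C/3 − d_C‖ < 1` with `3 ∤ d_A d_B − (d_C − d_A − d_B)²`, then
`det Gram_D(P, Q) ≠ 0`. [cite: MazurSteinTate2006, §1–2 (canonical 3-adic height, quadraticity)] -/
theorem padicRegulatorOf_pair_ne_zero_of_digits (P Q : W.toAffine.Point) (N₁ N₂ : ℕ)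
    {dA dB dC : ℤ} (hA : ‖D.pairing (N₁ • P) (N₁ • P) / 3 - dA‖ < 1)
    (hB : ‖D.pairing (N₂ • Q) (N₂ • Q) / 3 - dB‖ < 1)
    (hC : ‖D.pairing (N₁ • P + N₂ • Q) (N₁ • P + N₂ • Q) / 3 - dC‖ < 1)
    (hcrit : ¬ (3 : ℤ) ∣ dA * dB - (dC - dA - dB) ^ 2) :
    padicRegulatorOf D ![P, Q] ≠ 0 := by
  intro hdet
  have hX := four_mul_sq_mul_padicRegulatorOf_pair D P Q N₁ N₂
  rw [hdet, mul_zero] at hX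
  exact four_mul_mul_sub_sq_ne_zero_of_digits hA hB hC hcrit hX

/-- **Schneider at `3` in rank two from first digits.** Under the digit hypotheses of
`padicRegulatorOf_pair_ne_zero_of_digits` and `rank E(ℚ) = 2`, Schneider's conjecture holds for the
datum `D` (tree: `schneiderConjecture_of_padicRegulatorOf_pair_ne_zero`).
[cite: Schneider1982PadicHeightI, §1 (non-degeneracy conjecture)] -/
theorem schneiderConjecture_of_digits [W.IsElliptic] (P Q : W.toAffine.Point) (N₁ N₂ : ℕ)
    {dA dB dC : ℤ} (hA : ‖D.pairing (N₁ • P) (N₁ • P) / 3 - dA‖ < 1)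
    (hB : ‖D.pairing (N₂ • Q) (N₂ • Q) / 3 - dB‖ < 1)
    (hC : ‖D.pairing (N₁ • P + N₂ • Q) (N₁ • P + N₂ • Q) / 3 - dC‖ < 1)
    (hcrit : ¬ (3 : ℤ) ∣ dA * dB - (dC - dA - dB) ^ 2) (hrank : W.mordellWeilRank = 2) :
    SchneiderConjecture D :=
  schneiderConjecture_of_padicRegulatorOf_pair_ne_zero D P Q hrank
    (padicRegulatorOf_pair_ne_zero_of_digits D P Q N₁ N₂ hA hB hC hcrit)

/-- **The two-height certificate** (no third digit needed): if `A/3` and `B/3` have first digits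
`d_A, d_B` with `d_A d_B ≡ 2 (mod 3)` (a non-square of `𝔽₃`) and `‖C‖ ≤ 3⁻¹`, then
`det Gram_D(P, Q) ≠ 0`. [cite: MazurSteinTate2006, §1–2 (canonical 3-adic height, quadraticity)] -/
theorem padicRegulatorOf_pair_ne_zero_of_nonresidue_digits (P Q : W.toAffine.Point) (N₁ N₂ : ℕ)
    {dA dB : ℤ} (hA : ‖D.pairing (N₁ • P) (N₁ • P) / 3 - dA‖ < 1)
    (hB : ‖D.pairing (N₂ • Q) (N₂ • Q) / 3 - dB‖ < 1)
    (hC : ‖D.pairing (N₁ • P + N₂ • Q) (N₁ • P + N₂ • Q)‖ ≤ (3 : ℝ)⁻¹)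
    (h2 : dA * dB % 3 = 2) : padicRegulatorOf D ![P, Q] ≠ 0 := by
  obtain ⟨dC, hdC⟩ := exists_digit_of_norm_le hC
  exact padicRegulatorOf_pair_ne_zero_of_digits D P Q N₁ N₂ hA hB hdC
    (not_three_dvd_sub_sq_of_mul_emod_eq_two h2 _)

/-- **Schneider at `3` in rank two from the two-height certificate.**
[cite: Schneider1982PadicHeightI, §1 (non-degeneracy conjecture)] -/
theorem schneiderConjecture_of_nonresidue_digits [W.IsElliptic] (P Q : W.toAffine.Point)
    (N₁ N₂ : ℕ) {dA dB : ℤ} (hA : ‖D.pairing (N₁ • P) (N₁ • P) / 3 - dA‖ < 1)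
    (hB : ‖D.pairing (N₂ • Q) (N₂ • Q) / 3 - dB‖ < 1)
    (hC : ‖D.pairing (N₁ • P + N₂ • Q) (N₁ • P + N₂ • Q)‖ ≤ (3 : ℝ)⁻¹)
    (h2 : dA * dB % 3 = 2) (hrank : W.mordellWeilRank = 2) : SchneiderConjecture D :=
  schneiderConjecture_of_padicRegulatorOf_pair_ne_zero D P Q hrank
    (padicRegulatorOf_pair_ne_zero_of_nonresidue_digits D P Q N₁ N₂ hA hB hC h2)

end Certificate

/-! ### §4 Toward I4loc: member-wise certificates give the density-one Schneider clause
(the «every member ⇒ density one» step is the landed STUB 4 of the line, seat cd-density-one) -/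

/-- **I4loc from member-wise Schneider on a nonempty door family** (BY NAME): a large `Φ` with
nonempty local conditions and the local door conditions member-wise, ONE member, and Schneider at `3`
for every canonical datum on every good-ordinary globally minimal model of rank two of every member
give `SchneiderOnDoorSubfamily`. [cite: Schneider1982PadicHeightI, §1 (non-degeneracy conjecture)] -/
theorem schneiderOnDoorSubfamily_of_memberwise (Φ : CongruenceFamily₂) (hL : Φ.IsLarge)
    (hne : ∀ p : ℕ, p.Prime → (Φ.residues p).Nonempty)
    (hloc : ∀ a : Params, Φ.Mem a → a.curve.HasIrreducibleModPGaloisRep 3 ∧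
      ∀ (C : VariableChange ℚ) (hC : (C • a.curve).IsGloballyMinimal),
        @IsOrdinaryAt (C • a.curve) hC 3 _ ∧ ∃ ℓ : ℕ, ∃ _ : Fact ℓ.Prime, ℓ ≠ 3 ∧
          (C • a.curve).HasMultiplicativeReductionAtPrime ℓ ∧
          ¬ 3 ∣ padicValInt ℓ (@minimalDiscriminantInt (C • a.curve) hC))
    (hmem : ∃ a, Φ.Mem a)
    (hSch : ∀ a : Params, Φ.Mem a → ∀ (C : VariableChange ℚ) (hC : (C • a.curve).IsGloballyMinimal),
      @IsOrdinaryAt (C • a.curve) hC 3 _ → (C • a.curve).mordellWeilRank = 2 →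
      ∀ Dh : PAdicHeightData (C • a.curve) 3, Dh.IsCanonical → SchneiderConjecture Dh) :
    SchneiderOnDoorSubfamily :=
  ⟨Φ, hL, hne, hloc,
    CountingDoorF2AtThreeSchneiderOnDoorSubfamilyStubHasDensityOnOneOfForall.stub_hasDensityOn_one_of_forall
      Φ _ hmem hSch⟩

/-- **I4loc from a member-wise two-height digit certificate** (the composition of the line
«valuation class at 3», BY NAME): if, on a large `Φ` with nonempty local conditions, the local door
conditions and at least one member, every canonical `3`-adic height datum `Dh` on every good-ordinary
globally minimal model of rank two of every member admits points `P, Q` and multipliers `N₁, N₂`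
with `‖⟨N₁P,N₁P⟩/3 − d_A‖ < 1`, `‖⟨N₂Q,N₂Q⟩/3 − d_B‖ < 1`, `d_A d_B ≡ 2 (mod 3)` and
`‖⟨N₁P+N₂Q, N₁P+N₂Q⟩‖ ≤ 3⁻¹` (on `F₂`: the transported marked points, `N₁ = 2`, `N₂ = 3`), then
`SchneiderOnDoorSubfamily`. [cite: MazurSteinTate2006, §1–2 (canonical 3-adic height); Schneider1982PadicHeightI, §1] -/
theorem schneiderOnDoorSubfamily_of_digitCertificate (Φ : CongruenceFamily₂) (hL : Φ.IsLarge)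
    (hne : ∀ p : ℕ, p.Prime → (Φ.residues p).Nonempty)
    (hloc : ∀ a : Params, Φ.Mem a → a.curve.HasIrreducibleModPGaloisRep 3 ∧
      ∀ (C : VariableChange ℚ) (hC : (C • a.curve).IsGloballyMinimal),
        @IsOrdinaryAt (C • a.curve) hC 3 _ ∧ ∃ ℓ : ℕ, ∃ _ : Fact ℓ.Prime, ℓ ≠ 3 ∧
          (C • a.curve).HasMultiplicativeReductionAtPrime ℓ ∧
          ¬ 3 ∣ padicValInt ℓ (@minimalDiscriminantInt (C • a.curve) hC))
    (hmem : ∃ a, Φ.Mem a)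
    (hcert : ∀ a : Params, Φ.Mem a → ∀ (C : VariableChange ℚ) (hC : (C • a.curve).IsGloballyMinimal),
      @IsOrdinaryAt (C • a.curve) hC 3 _ → (C • a.curve).mordellWeilRank = 2 →
      ∀ Dh : PAdicHeightData (C • a.curve) 3, Dh.IsCanonical →
        ∃ (P Q : (C • a.curve).toAffine.Point) (N₁ N₂ : ℕ) (dA dB : ℤ),
          ‖Dh.pairing (N₁ • P) (N₁ • P) / 3 - dA‖ < 1 ∧ ‖Dh.pairing (N₂ • Q) (N₂ • Q) / 3 - dB‖ < 1 ∧
          ‖Dh.pairing (N₁ • P + N₂ • Q) (N₁ • P + N₂ • Q)‖ ≤ (3 : ℝ)⁻¹ ∧ dA * dB % 3 = 2) :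
    SchneiderOnDoorSubfamily := by
  refine schneiderOnDoorSubfamily_of_memberwise Φ hL hne hloc hmem fun a ha C hC hord hr Dh hDh ↦ ?_
  haveI : a.curve.IsElliptic := Params.isElliptic_curve ha.1
  obtain ⟨P, Q, N₁, N₂, dA, dB, hA, hB, hC', h2⟩ := hcert a ha C hC hord hr Dh hDh
  exact schneiderConjecture_of_nonresidue_digits Dh P Q N₁ N₂ hA hB hC' h2 hr

end Summit.BirchSwinnertonDyer.BirchSwinnertonDyer.Theorems

end
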